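import Mathlib.FieldTheory.Minpoly.IsIntegrallyClosed
import Literature.NumberTheory.Automorphic.CDTTheorem722ThreeFactsProofs
import Literature.NumberTheory.Automorphic.SerreConjectureProofs
import Literature.NumberTheory.Automorphic.BCDTModularitySerreProofs
import Literature.NumberTheory.Automorphic.BCDTModularityModPProofs
import Literature.NumberTheory.GaloisRepresentations.OddAbsolutelyIrreducibleProofs
import Literature.NumberTheory.EllipticCurves.ModPIrreducibleCofinite
import Literature.NumberTheory.EllipticCurves.NewformsFiniteProofs
import HarnessLib

/-!
# CDT Theorem 7.2.2, proofs file III: Serre's road — an elliptic curve over `ℚ` is modular if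
# `ρ̄_{E,p}` is modular of weight `2` and bounded level for infinitely many `p`
# (Serre, Duke Math. J. 54 (1987), §4.6, Théorème 4), and Theorem 7.2.2 from Khare–Wintenberger

Sibling *proofs* file (theorems only: no definition, no named fact, no instance, no `sorry`) of
`Literature.NumberTheory.Automorphic.CDTTheorem722`, `…Proofs`, `…ThreeFactsProofs`, for the
named fact `Literature.NumberTheory.Automorphic.BCDT.CDT_theorem_7_2_2` (Conrad–Diamond–Taylor,
J. Amer. Math. Soc. 12 (1999), Thm. 7.2.2: *"Let `E/ℚ` be an elliptic curve such that
`ρ̄_{E,5}|ℚ(√5)` is absolutely irreducible. If `ρ̄_{E,5}` is modular, then `E` is modular."*).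

State of the tree before this file (`CDTTheorem722ThreeFactsProofs`): granted the three catalogued
classical facts `eichlerShimuraConstruction` (Eichler–Shimura), `WeierstrassCurve.isIsogenous_iff_
frobeniusTrace_eq` (Faltings) and `IsNewformOf.level_eq_conductorNorm` (Carayol), the fact
`CDT_theorem_7_2_2` is *equivalent* to the `5`-adic modularity lifting statement of its printed
proof (CDT Thm. 7.1.1 = the `R = T` theorem 5.4.2 with Diamond 1996 Thm. 5.3, Lemma 7.1.3, §2.2,
§B.2 / Prop. B.4.2, Conrad 1999 Thm. 5.3), which cannot at present be stated in Mathlib's language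
(no `p`-adic Hodge theory, no deformation rings).

**This file formalizes the other published road to the conclusion of Theorem 7.2.2 — Serre's.**
Serre, *Sur les représentations modulaires de degré `2` de `Gal(ℚ̄/ℚ)`*, Duke Math. J. 54 (1987),
§4.6 (= Œuvres IV, no. 143):

> **THÉORÈME 4.** *Admettons (3.3.1_?). Alors `E` est une courbe de Weil de niveau `N`.*

((3.3.1_?) is his conjecture (3.2.4_?) in the case `k = 2`, `ε = 1`: an absolutely irreducible
`ρ : G_ℚ → GL₂(𝔽_p)` with `det ρ = χ`, finite at `p`, arises from a cusp form of weight `2` and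
level `N(ρ)`.)  Printed proof: for `p ≥ C_E`, `ρ_p^E` (the `p`-torsion representation) is
irreducible (Lemme 5, (4.6.2): Mazur) with conductor `N_p = N` ((4.6.3); "`N_p` divise `N` (ce qui
d'ailleurs suffirait pour la suite)"), of weight `2` (good reduction ⇒ finite at `p`, §2.8 Prop. 4)
and `ε = 1` ((4.6.1) `det ρ_p^E = χ`, n° 1.3); by (3.3.1_?) and the Deligne–Serre lifting lemma
(3.1.6), `ρ_p^E ≅ ρ̃_F` for an eigenform `F` of weight `2` and level `N` in characteristic `0`;
*"il n'y a qu'un nombre fini de `F` possibles, puisque le poids et le niveau sont fixés"*, so one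
`F` serves an infinite set `P` of primes; for `l ∤ N` and `p ∈ P ∖ {l}`, `A_l ≡ a_l (mod p)`, and
*"l'entier algébrique `A_l - a_l` a une image dans `𝔽̄_p` qui est égale à `0` pour tout `p ∈ P`,
`p ≠ l`. Comme `P` est infini, cela entraîne (4.6.4) `A_l = a_l`"*; the `A_l` are integers and
define a Weil curve `E_F` (Eichler–Shimura) with `E ~ E_F` (Faltings); `F` is primitive (Remarque
(2), Carayol).  Since Khare–Wintenberger (Invent. Math. 178 (2009), Thms. 1.2 and 9.1, with Kisin)
proved (3.2.4_?) — the tree's named fact `khare_wintenberger p k` (`SerreConjecture`) — this road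
reaches "`E` is modular" from `khare_wintenberger` and *local* statements about `E[p]`, with no
modularity lifting theorem.

## Main statements (all proved; namespace `Literature.NumberTheory.Automorphic.BCDT`)

* `isModular_of_forall_isTorsionGaloisRep_exists_isNewform1_of_three_facts` — **Serre's
  Théorème 4 in the tree**: if for all primes `p ≥ p₀` every framed model `ρ̄` of `E[p]` becomes,
  after extension of scalars to a field of characteristic `p`, attached modulo a prime above `p`
  to a newform `f_p ∈ S₂(Γ₁(N_p))` with `N_p ≤ M` (`IsGaloisRepOfNewform1Int`, the shape in which
  the tree states Serre's conjecture — the lift (3.1.6) is built in), then `E` is modular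
  (`IsModular W`), granted Eichler–Shimura, Faltings, Carayol.  Steps, each a theorem:
  `charpoly_baseChange_of_isTorsionGaloisRep` (`char(Frob_q | E[p]) = X² - a_q(E) X + q`, Silverman
  C.21.3 mod `p`, proved in the tree), `nebentypus_apply_eq_one_of_map_coeff_zero_eq` and
  `nebentypus_eq_one_of_forall_prime` (`ε_{f_p} = 1` for `p > M`: roots of unity of order
  `φ(N_p) < p` reduce injectively, `eq_one_of_pow_eq_one_of_map_eq_one`; Dirichlet's theorem),
  `exists_isNewform0_coe_eq_of_nebentypus_eq_one` (descent to `Γ₀(N_p)`), the pigeonhole over the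
  finitely many `Γ₀`-newforms of level `≤ M` (`finite_newforms0_holds`, Atkin–Lehner),
  `eq_zero_of_isIntegral_of_forall_exists_map_eq_zero` ("`A_l - a_l` … est égale à `0` pour une
  infinité de `p` … entraîne `A_l = a_l`", via the minimal polynomial over `ℤ`), and
  `isModular_of_isNewform0_of_cuspCoeff_eq_off_of_three_facts` (the last paragraph: integrality of
  all `aₙ`, Eichler–Shimura curve, Faltings, Carayol).
* `forall_isTorsionGaloisRep_exists_isNewform1_of_khare_wintenberger` — the hypothesis of the
  above from `khare_wintenberger p k` (`p ≥ p₀`, `k = 𝔽̄_p` discrete), the **weight**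
  `k(ρ̄_{E,p} ⊗ k) = 2` (`hwt`; Serre §2.8 Prop. 4 with "bonne réduction ⇒ finie en `p`") and the
  **level** `N(ρ̄_{E,p} ⊗ k) ∣ N_E` (`hlev`; Serre Lemme 5, (4.6.3)); irreducibility of `E[p]` for
  all large `p` is the tree's theorem `WeierstrassCurve.exists_forall_hasIrreducibleModPGaloisRep_
  of_lt` (Serre 1968 IV-2.1 / Silverman IX.6.3, proved; Serre cites Mazur (4.6.2)), transported to
  framed models (`isIrreducible_of_hasIrreducibleModPGaloisRep`) and upgraded to absolute
  irreducibility by oddness (`isAbsolutelyIrreducible_of_hasIrreducibleModPGaloisRep`, Serre n° 3.3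
  (b′) ⇒ (b); the Weil pairing `det ρ̄_{E,p} = χ̄_p` is proved in the tree).
* `isModular_of_khare_wintenberger_of_serreWeight_of_serreLevel_of_three_facts`,
  `exists_isNewformOf_of_khare_wintenberger_of_serreWeight_of_serreLevel_of_three_facts` (**BCDT
  Theorem A along Serre's road**) and
  `CDT_theorem_7_2_2_of_khare_wintenberger_of_serreWeight_of_serreLevel_of_three_facts`:
  trust base {`khare_wintenberger`, weight `2` and level `∣ N_E` of `ρ̄_{E,p}` for large `p`,
  `eichlerShimuraConstruction`, `WeierstrassCurve.isIsogenous_iff_frobeniusTrace_eq`,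
  `IsNewformOf.level_eq_conductorNorm`}.

The two local inputs `hwt`, `hlev` are hypotheses (printed statements: Serre 1987, §2.8 Prop. 4
and (4.6.3)); they are not vendored as named facts here (D-0026) — Raynaud's classification of
finite flat group schemes of type `(p, p)` and the comparison of the Artin conductor of `E[p]` with
`N_E` are not in the tree.

## References

* [Serre1987] J.-P. Serre, *Sur les représentations modulaires de degré `2` de `Gal(ℚ̄/ℚ)`*, Duke
  Math. J. 54 (1987), 179–230 (Œuvres IV, no. 143): §2.8 Prop. 4; §3.3 ((3.3.1_?), (b′) ⇒ (b));
  §4.6, Théorème 4, Lemme 5 ((4.6.1)–(4.6.4)) and Remarques (1)–(2).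
* [KhareWintenberger2009] C. Khare, J.-P. Wintenberger, *Serre's modularity conjecture (I)*,
  Invent. Math. 178 (2009), 485–504, Thm. 1.2, Thm. 9.1, §10.
* [ConradDiamondTaylor1999] B. Conrad, F. Diamond, R. Taylor, J. Amer. Math. Soc. 12 (1999),
  Thm. 7.2.2 (pp. 553–554).
* [BCDTJAMS2001] C. Breuil, B. Conrad, F. Diamond, R. Taylor, J. Amer. Math. Soc. 14 (2001),
  Introduction ((3) ⇒ (2): Carayol and Faltings).
* [SilvermanAEC2009] J. H. Silverman, *The Arithmetic of Elliptic Curves*, 2nd ed.: III.§7,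
  Cor. IX.6.3, C.21.3.
* [DiamondShurman2005] F. Diamond, J. Shurman, *A First Course in Modular Forms*: §4.3, Thm. 5.8.2,
  Thm. 9.4.1.

## Design

Theorems only; `noncomputable section`.  Coefficient fields of characteristic `p` are carried as
data `(K : Type) (_ : Field K) (_ : CharP K p) (_ : TopologicalSpace K)` inside the hypotheses, as
in `ModPGaloisRep.IsModular`; `𝔽̄_p = AlgebraicClosure (ZMod p)` gets the discrete topology by a
local `letI`, as in `BCDTModularitySerreProofs`.  Axioms of every theorem: `propext`,
`Classical.choice`, `Quot.sound`.
-/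

noncomputable section

open scoped MatrixGroups ModularForm NumberField
open CongruenceSubgroup UpperHalfPlane Polynomial

namespace Literature.NumberTheory.Automorphic.BCDT

open WeierstrassCurve GaloisRepresentations EllipticCurves EllipticCurves.ModularForms
  Rat.HeightOneSpectrum IsDedekindDomain IsDedekindDomain.HeightOneSpectrum

/-! ## Part A. Two lemmas of algebra -/

/-- **An algebraic integer which vanishes modulo infinitely many primes is zero.**  Let `ξ` be an
element of a domain `S` of characteristic zero, integral over `ℤ`.  Suppose that for infinitely
many primes `p` (for every bound `n` some `p > n`) there are a ring `R` mapping injectively to `S`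
by `e`, an element `x ∈ R` with `e x = ξ`, and a ring homomorphism `φ : R → K` to a ring of
characteristic `p` with `φ x = 0`.  Then `ξ = 0`: otherwise the constant coefficient `c ≠ 0` of the
minimal polynomial `m ∈ ℤ[X]` of `ξ` satisfies `c = m(0) ≡ m(x) = 0` in `K`, i.e. `p ∣ c`, for
infinitely many `p`.  (Serre, Duke Math. J. 54 (1987), §4.6, proof of Thm. 4: "l'entier algébrique
`A_l - a_l` a une image dans `𝔽̄_p` qui est égale à `0` pour tout `p ∈ P` … Comme `P` est infini,
cela entraîne `A_l = a_l`".) [cite: Serre1987, §4.6, proof of Théorème 4] -/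
theorem eq_zero_of_isIntegral_of_forall_exists_map_eq_zero {S : Type*} [CommRing S] [IsDomain S]
    [Algebra ℚ S] {ξ : S} (hξ : IsIntegral ℤ ξ) {ι : Type*} (p : ι → ℕ)
    (R : ι → Type*) [∀ i, CommRing (R i)] (e : ∀ i, R i →+* S)
    (he : ∀ i, Function.Injective (e i)) (x : ∀ i, R i) (hx : ∀ i, e i (x i) = ξ)
    (K : ι → Type*) [∀ i, CommRing (K i)] [∀ i, CharP (K i) (p i)] (φ : ∀ i, R i →+* K i)
    (hφ : ∀ i, φ i (x i) = 0) (hinf : ∀ n : ℕ, ∃ i, n < p i) : ξ = 0 := by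
  by_contra hξ0
  -- the minimal polynomial over `ℤ` and its non-zero constant coefficient
  set m : ℤ[X] := minpoly ℤ ξ with hm
  have hmQ : minpoly ℚ ξ = m.map (algebraMap ℤ ℚ) :=
    minpoly.isIntegrallyClosed_eq_field_fractions' ℚ hξ
  have hc : m.coeff 0 ≠ 0 := by
    intro h0
    have h1 : (minpoly ℚ ξ).coeff 0 = 0 := by
      rw [hmQ, Polynomial.coeff_map, h0, map_zero]
    exact hξ0 ((minpoly.coeff_zero_eq_zero (hξ.tower_top)).mp h1)
  -- a prime `p i` beyond `|c|`
  obtain ⟨i, hi⟩ := hinf (m.coeff 0).natAbs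
  -- `m(x i) = 0` in `R i` (test after `e i`), hence `c = m(0) = φ (m (x i)) = 0` in `K i`
  have hRx : aeval (x i) m = 0 := by
    apply he i
    rw [map_zero, Polynomial.aeval_def, Polynomial.hom_eval₂,
      RingHom.ext_int ((e i).comp (algebraMap ℤ (R i))) (algebraMap ℤ S), hx i,
      ← Polynomial.aeval_def, hm, minpoly.aeval]
  have hK : ((m.coeff 0 : ℤ) : K i) = 0 := by
    have h := congrArg (φ i) hRx
    rw [map_zero, Polynomial.aeval_def, Polynomial.hom_eval₂,
      RingHom.ext_int ((φ i).comp (algebraMap ℤ (R i))) (algebraMap ℤ (K i)), hφ i,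
      ← Polynomial.aeval_def, ← Polynomial.coeff_zero_eq_aeval_zero', eq_intCast] at h
    exact h
  have hdvd : (p i : ℤ) ∣ m.coeff 0 := (CharP.intCast_eq_zero_iff (K i) (p i) _).mp hK
  have hle : p i ≤ (m.coeff 0).natAbs :=
    Nat.le_of_dvd (Int.natAbs_pos.mpr hc) (Int.natCast_dvd.mp hdvd)
  omega

/-- **Roots of unity of order prime to `p` reduce injectively modulo `p`.**  In a domain `R`, if
`ζ ^ n = 1` and a ring homomorphism `φ : R → K` to a ring of characteristic `p ∤ n` sends `ζ` to `1`,
then `ζ = 1`: otherwise `1 + ζ + ⋯ + ζ^{n-1} = (ζ^n - 1)/(ζ - 1) = 0`, whose image under `φ` is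
`n ≠ 0` in `K`.  (`X^n - 1` is separable modulo `p ∤ n`.) [folklore] -/
theorem eq_one_of_pow_eq_one_of_map_eq_one {R : Type*} [CommRing R] [IsDomain R] {K : Type*}
    [CommRing K] {p : ℕ} [CharP K p] (φ : R →+* K) {ζ : R} {n : ℕ} (hn : ¬ p ∣ n)
    (hζ : ζ ^ n = 1) (hφ : φ ζ = 1) : ζ = 1 := by
  by_contra hne
  have hsum : (∑ i ∈ Finset.range n, ζ ^ i) = 0 := by
    have h := geom_sum_mul ζ n
    rw [hζ, sub_self] at h
    exact (mul_eq_zero.mp h).resolve_right (sub_ne_zero.mpr hne)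
  have h2 := congrArg φ hsum
  rw [map_sum, map_zero] at h2
  simp only [map_pow, hφ, one_pow, Finset.sum_const, Finset.card_range, nsmul_eq_mul,
    mul_one] at h2
  exact hn ((CharP.cast_eq_zero_iff K p n).mp h2)

/-! ## Part B. Assembly: a `Γ₀(N)`-newform with `a_q = a_q(E)` off finitely many primes -/

/-- **From a newform `g ∈ S₂(Γ₀(N))` with `a_q(g) = a_q(E)` for all primes `q ∤ N R` to "`E` is
modular"**, granted Eichler–Shimura (`hES`), Faltings (`hF`) and Carayol (`hC`) — the last
paragraph of Serre's proof (Duke Math. J. 54 (1987), §4.6, proof of Thm. 4 and Remarque (2)):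
the `a_q(g)`, `q` prime, are integers (rational off `N R`, hence all of them by conjugation and
strong multiplicity one, `IsNewform0.exists_int_eq_coeff_prime_of_off` with Deligne–Serre (2.7.2)
proved, `span_integralLattice1_two`), so are all `aₙ(g)` (`IsNewform0.exists_int_eq_cuspCoeff`);
"Ils définissent une courbe de Weil `E_F` de niveau un diviseur de `N`" (`hES`); "les
représentations `l`-adiques attachées à `E` et `E_F` sont isomorphes, et l'on sait (Faltings) que
cela entraîne que `E` et `E_F` sont isogènes sur `ℚ`" (`isIsogenous_of_finite_setOf_LFunction_ne`,
`hF`), whence `L(E, s) = L(E_F, s) = L(g, s)` (`IsIsogenous.LFunction_eq`); "La forme `F` … est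
primitive; cela résulte d'un théorème de Carayol" — here: its level is `N_E` (`hC`).
[cite: Serre1987, §4.6, proof of Théorème 4 and Remarque (2)] -/
theorem isModular_of_isNewform0_of_cuspCoeff_eq_off_of_three_facts
    (hES : eichlerShimuraConstruction)
    (hF : WeierstrassCurve.isIsogenous_iff_frobeniusTrace_eq)
    (hC : ∀ (N : ℕ) [NeZero N], IsNewformOf.level_eq_conductorNorm (N := N))
    (W : WeierstrassCurve ℚ) [W.IsElliptic] [NeZero (W.conductorNorm ℤ)] {N : ℕ} [NeZero N]
    {g : CuspForm (Gamma0 N) 2} (hg : IsNewform0 g) {R : ℕ} [NeZero R]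
    (h : ∀ q : ℕ, q.Prime → ¬ q ∣ N * R → cuspCoeff g q = (W.LFunction q : ℂ)) : IsModular W := by
  classical
  -- all Fourier coefficients of `g` are integers
  have hprime : ∀ q : ℕ, q.Prime → ∃ z : ℤ, (z : ℂ) = (qExpansion 1 ⇑g).coeff q :=
    hg.exists_int_eq_coeff_prime_of_off (by norm_num) (span_integralLattice1_two N) (R := R)
      fun q hq hqM ↦ ⟨W.LFunction q, by rw [Rat.cast_intCast]; exact (h q hq hqM).symm⟩
  have hint : ∀ n : ℕ, ∃ z : ℤ, cuspCoeff g n = z := hg.exists_int_eq_cuspCoeff (by norm_num) hprime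
  haveI : NeZero (N * R) := ⟨mul_ne_zero (NeZero.ne N) (NeZero.ne R)⟩
  -- the Eichler–Shimura curve `E_g` and Faltings: `E ~ E_g`
  obtain ⟨W', hW', hW'g, -⟩ := hES hg hint
  have hiso : IsIsogenous W W' := by
    refine WeierstrassCurve.isIsogenous_of_finite_setOf_LFunction_ne hF W W' ?_
    refine (N * R).primeFactors.finite_toSet.subset ?_
    rintro q ⟨hq, hne⟩
    refine (Nat.mem_primeFactors_of_ne_zero (NeZero.ne _)).mpr ⟨hq, ?_⟩
    by_contra hqM
    exact hne (by exact_mod_cast (h q hq hqM).symm.trans (hW'g.2 q))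
  -- `L(E, s) = L(E_g, s) = L(g, s)`, and the level is the conductor
  have hWg : IsNewformOf W g := ⟨hg, fun n ↦ by rw [hW'g.2 n, hiso.LFunction_eq]⟩
  have hNE : N = W.conductorNorm ℤ := hC N hWg
  subst hNE
  exact ⟨g, hWg⟩

/-! ## Part C. The newform side: coefficients of the integral Hecke polynomial, `ε = 1`, descent -/

section NewformSide

variable {N : ℕ} [NeZero N] {k : ℤ} {f : CuspForm (Gamma1 N) k}

/-- The composite `𝓞_f → K_f → ℂ` is injective. [folklore] -/
theorem algebraMap_coeffCharIntegers_complex_injective (f : CuspForm (Gamma1 N) k) :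
    Function.Injective
      ((algebraMap (coeffCharField f) ℂ).comp
        (algebraMap (coeffCharIntegers f) (coeffCharField f))) :=
  (algebraMap (coeffCharField f) ℂ).injective.comp fun _ _ h ↦ Subtype.ext h

/-- **Coefficients of the integral lift of the Hecke polynomial.**  If `P ∈ 𝓞_f[X]` maps to
`X² - a_q(f) X + ε(q) q^{k-1} ∈ K_f[X]`, then in `ℂ` its `X`-coefficient is `-a_q(f)` and its
constant coefficient is `ε(q) q^{k-1}`. [folklore] -/
theorem coeff_of_map_eq_heckePolynomial {q : ℕ} {P : Polynomial (coeffCharIntegers f)}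
    (hP : P.map (algebraMap (coeffCharIntegers f) (coeffCharField f)) = heckePolynomial f q) :
    (algebraMap (coeffCharField f) ℂ)
        ((algebraMap (coeffCharIntegers f) (coeffCharField f)) (P.coeff 1)) =
        -(qExpansion 1 ⇑f).coeff q ∧
      (algebraMap (coeffCharField f) ℂ)
        ((algebraMap (coeffCharIntegers f) (coeffCharField f)) (P.coeff 0)) =
        (nebentypus f (q : ZMod N) : ℂ) * (q : ℂ) ^ (k - 1) := by
  have h := congrArg (fun Q : Polynomial (coeffCharField f) ↦
    Q.map (algebraMap (coeffCharField f) ℂ)) hP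
  simp only [Polynomial.map_map, map_heckePolynomial] at h
  have h1 := congrArg (fun Q : ℂ[X] ↦ Q.coeff 1) h
  have h0 := congrArg (fun Q : ℂ[X] ↦ Q.coeff 0) h
  simp only [Polynomial.coeff_map, RingHom.coe_comp, Function.comp_apply, coeff_add, coeff_sub,
    coeff_X_pow, coeff_C_mul, coeff_X_one, coeff_X_zero, coeff_C_zero, coeff_C_succ] at h1 h0
  refine ⟨?_, ?_⟩
  · rw [h1]; simp
  · rw [h0]; simp

/-- **The nebentypus is trivial at `q` as soon as `ε(q) q ≡ q` modulo one large prime.**  Let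
`f ∈ S₂(Γ₁(N))`, `q ∤ N` a prime, `P ∈ 𝓞_f[X]` the integral lift of `X² - a_q X + ε(q) q`, and
`ι : 𝓞_f → K` a ring homomorphism to a field of characteristic `p` with `p > N`, `p ≠ q`, such that
`ι(P(0)) = q`.  Then `ε(q) = 1`: `ε(q)` is a root of unity of order dividing `φ(N) < p` with
`ι(ε(q)) q = q ≠ 0` in `K`, and roots of unity of order prime to `p` reduce injectively
(`eq_one_of_pow_eq_one_of_map_eq_one`).  (In Serre's proof this is "`ε = 1`" of n° 3.3 with
n° 1.3, obtained there from `det ρ̄ = χ`.) [cite: Serre1987, §3.3 and §4.6] -/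
theorem nebentypus_apply_eq_one_of_map_coeff_zero_eq {f : CuspForm (Gamma1 N) 2} {q : ℕ}
    (hq : q.Prime) (hqN : ¬ q ∣ N) {P : Polynomial (coeffCharIntegers f)}
    (hP : P.map (algebraMap (coeffCharIntegers f) (coeffCharField f)) = heckePolynomial f q)
    {K : Type*} [Field K] {p : ℕ} [Fact p.Prime] [CharP K p] (ι : coeffCharIntegers f →+* K)
    (hqp : q ≠ p) (hpN : N < p) (h0 : ι (P.coeff 0) = (q : K)) :
    nebentypus f (q : ZMod N) = 1 := by
  have hp : p.Prime := Fact.out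
  set e := (algebraMap (coeffCharField f) ℂ).comp
    (algebraMap (coeffCharIntegers f) (coeffCharField f)) with he
  have hinj : Function.Injective e := algebraMap_coeffCharIntegers_complex_injective f
  -- `ε(q)` as an algebraic integer `Z ∈ 𝓞_f`, a root of unity of order dividing `φ(N)`
  obtain ⟨u, hu⟩ := (ZMod.isUnit_prime_iff_not_dvd hq).mpr hqN
  set ζ : ℂ := (nebentypus f (q : ZMod N) : ℂ) with hζ
  have hζpow : ζ ^ Nat.totient N = 1 := by
    rw [hζ, ← hu, ← map_pow, ← Units.val_pow_eq_pow_val, ZMod.pow_totient, Units.val_one,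
      map_one]
  have hζint : IsIntegral ℤ (⟨ζ, nebentypus_mem_coeffCharField f q⟩ : coeffCharField f) := by
    rw [isIntegral_coeffCharField_iff]
    exact isIntegral_dirichletCharacter_apply _ _
  set Z : coeffCharIntegers f := ⟨⟨ζ, nebentypus_mem_coeffCharField f q⟩, hζint⟩ with hZ
  have heZ : e Z = ζ := rfl
  have hZpow : Z ^ Nat.totient N = 1 := hinj (by rw [map_pow, heZ, hζpow, map_one])
  -- `P(0) = Z q` in `𝓞_f`, hence `ι(Z) q = q` and `ι(Z) = 1`
  have hP0 : P.coeff 0 = Z * (q : coeffCharIntegers f) := by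
    apply hinj
    rw [map_mul, map_natCast, heZ, he, RingHom.comp_apply, (coeff_of_map_eq_heckePolynomial hP).2,
      show ((2 : ℤ) - 1) = 1 from rfl, zpow_one]
  have hqK : (q : K) ≠ 0 := by
    rw [Ne, CharP.cast_eq_zero_iff K p q]
    exact fun h ↦ hqp ((Nat.prime_dvd_prime_iff_eq hp hq).mp h).symm
  have hιZ : ι Z = 1 := by
    have h := h0
    rw [hP0, map_mul, map_natCast] at h
    exact (mul_eq_right₀ hqK).mp h
  have hndvd : ¬ p ∣ Nat.totient N := fun h ↦
    (Nat.le_of_dvd (Nat.totient_pos.mpr (NeZero.pos N)) h).not_gt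
      ((Nat.totient_le N).trans_lt hpN)
  have hZ1 : Z = 1 := eq_one_of_pow_eq_one_of_map_eq_one ι hndvd hZpow hιZ
  have h := congrArg e hZ1
  rw [heZ, map_one] at h
  exact_mod_cast h

/-- **A Dirichlet character trivial at all large primes is trivial** (Dirichlet's theorem on primes
in arithmetic progressions, Mathlib `Nat.forall_exists_prime_gt_and_eq_mod`): if `ε_f(q) = 1`
for every prime `q > B` not dividing `N`, then `ε_f = 1`. [folklore] -/
theorem nebentypus_eq_one_of_forall_prime (B : ℕ)
    (h : ∀ q : ℕ, q.Prime → B < q → ¬ q ∣ N → nebentypus f (q : ZMod N) = 1) :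
    nebentypus f = 1 := by
  refine MulChar.ext fun u ↦ ?_
  obtain ⟨q, hgt, hq, hqu⟩ := Nat.forall_exists_prime_gt_and_eq_mod u.isUnit B
  have hqN : ¬ q ∣ N := (ZMod.isUnit_prime_iff_not_dvd hq).mp (hqu ▸ u.isUnit)
  rw [MulChar.one_apply_coe, ← hqu]
  exact h q hq hgt hqN

/-- **Descent `Γ₁(N) → Γ₀(N)` for trivial nebentypus.**  A newform `f ∈ S_k(Γ₁(N))` with `ε_f = 1`
is fixed by the diamond operators, hence is (the image of) a newform `g ∈ S_k(Γ₀(N))` with the same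
`q`-expansion (Diamond–Shurman §4.3, `S_k(Γ₀(N)) = S_k(N, 𝟙)`; the tree's
`exists_liftToGamma1_eq_of_forall_diamondOp_eq`, `isNewform1_liftToGamma1_iff_holds`,
`coe_liftToGamma1_holds`). [cite: DiamondShurman2005, §4.3] -/
theorem exists_isNewform0_coe_eq_of_nebentypus_eq_one (hf : IsNewform1 f) (hε : nebentypus f = 1) :
    ∃ g : CuspForm (Gamma0 N) k, IsNewform0 g ∧ (⇑g : UpperHalfPlane → ℂ) = ⇑f := by
  have hdia : ∀ d : ZMod N, IsUnit d → diamondOp N k d f = f := by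
    intro d hd
    obtain ⟨u, rfl⟩ := hd
    rw [hf.diamondOp_apply_eq_nebentypus_smul u, hε, MulChar.one_apply_coe, one_smul]
  obtain ⟨g, hg⟩ := exists_liftToGamma1_eq_of_forall_diamondOp_eq k f hdia
  refine ⟨g, (isNewform1_liftToGamma1_iff_holds N k g).mp (hg ▸ hf), ?_⟩
  rw [← hg, coe_liftToGamma1_holds]

end NewformSide

/-! ## Part D. The elliptic-curve side: Frobenius polynomials of `ρ̄_{E,p} ⊗ K` -/

/-- **`char(Frob_q | E[p] ⊗ K) = X² - a_q(E) X + q`** for a prime `q ≠ p` of good reduction: the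
Frobenius polynomial of `ρ̄_{E,p}` at `q` is `X² - ā_q X + q̄ ∈ 𝔽_p[X]`
(`IsTorsionGaloisRep.charpoly_eq_of_isArithFrobAt`, Silverman *AEC* C.21.3 read modulo `p`, with
the trace and determinant of Frobenius on `T_p E` proved in the tree), `a_q(E)` being the `q`-th
coefficient of `L(E, s)` (`lFunction_primesEquiv_eq_frobeniusTraceAt`); base change along
`j : 𝔽_p → K` maps it coefficientwise (`Matrix.charpoly_map`).  (Serre 1987, §4.6: "Soit `a_l` la
trace de l'endomorphisme de Frobenius correspondant. On a `a_l ≡ a_{l,p} (mod p)`".)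
[cite: Serre1987, §4.6, proof of Théorème 4] -/
theorem charpoly_baseChange_of_isTorsionGaloisRep (W : WeierstrassCurve ℚ) [W.IsElliptic] {p : ℕ}
    [Fact p.Prime] {ρ : ModPGaloisRep ℚ (ZMod p) 2} (hρ : W.IsTorsionGaloisRep p ρ)
    {K : Type*} [CommRing K] [TopologicalSpace K] (j : ZMod p →+* K) (hj : Continuous j)
    {v : HeightOneSpectrum (𝓞 ℚ)} (hpv : (primesEquiv v : ℕ) ≠ p) (hv : W.HasGoodReductionAt v)
    {𝔓 : Ideal (absIntegers (𝓞 ℚ) ℚ)} (h𝔓 : 𝔓 ∈ v.primesAbove)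
    {σ : Field.absoluteGaloisGroup ℚ} (hσ : IsArithFrobAt (𝓞 ℚ) σ 𝔓) :
    FramedRep.charpoly (FramedRep.baseChange j hj ρ) σ =
      X ^ 2 - C ((W.LFunction (primesEquiv v : ℕ) : ℤ) : K) * X + C ((primesEquiv v : ℕ) : K) := by
  have hp : p.Prime := Fact.out
  have hpv' : ((p : ℕ) : 𝓞 ℚ) ∉ v.asIdeal := by
    rw [GaloisRepresentations.Rat.natCast_mem_asIdeal_iff]
    exact fun h' ↦ hpv ((Nat.prime_dvd_prime_iff_eq (primesEquiv v).2 hp).mp h')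
  have hch := hρ.charpoly_eq_of_isArithFrobAt
    (W.trace_galoisRepTate_frobenius_of_hasGoodReductionAt_holds p)
    (W.det_galoisRepTate_frobenius_of_hasGoodReductionAt_holds p) hpv' hv h𝔓 hσ
  rw [WeierstrassCurve.natCard_residueField_adicCompletionIntegers,
    ← W.lFunction_primesEquiv_eq_frobeniusTraceAt hv] at hch
  change (((ρ σ : GL (Fin 2) (ZMod p)) : Matrix (Fin 2) (Fin 2) (ZMod p)).map j).charpoly = _
  rw [Matrix.charpoly_map, hch, Polynomial.map_add, Polynomial.map_sub, Polynomial.map_mul,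
    Polynomial.map_pow, Polynomial.map_X, Polynomial.map_C, Polynomial.map_C, map_intCast,
    map_natCast]

/-! ## Part E. Serre 1987, §4.6, Théorème 4: `E` is modular if `ρ̄_{E,p}` arises from a newform
of weight `2` and bounded level for infinitely many `p` -/

/-- **Serre, Duke Math. J. 54 (1987), §4.6, Théorème 4 — the deduction of the modularity of an
elliptic curve `E/ℚ` from his conjecture in the case `k = 2`, `ε = 1` ((3.3.1), applied to
`ρ̄_{E,p}` for infinitely many `p`), granted Eichler–Shimura, Faltings and Carayol.**

Printed statement: *"THÉORÈME 4. Admettons (3.3.1_?). Alors `E` est une courbe de Weil de niveau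
`N`."*  Printed proof (loc. cit.): for `p ≥ C_E`, `ρ̄_p^E` is irreducible of conductor `N`
(Lemme 5; "le conducteur `N_p` de `ρ_p^E` divise `N` (ce qui d'ailleurs suffirait pour la
suite)"), so by (3.3.1_?) `ρ̄_p^E ≅ ρ_{f_p}` for an eigenform `f_p` of weight `2` and level `N`
mod `p`, which lifts (3.1.6) to an eigenform `F` of weight `2` and level `N` in characteristic
`0`; "A priori, `F` dépend de `p`. Mais il n'y a qu'un nombre fini de `F` possibles, puisque le
poids et le niveau sont fixés. On en conclut qu'il existe un choix de `F` tel que l'on ait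
`F̃ = f_p` pour tout `p ∈ P`, où `P` est un ensemble infini de nombres premiers"; for `l ∤ N`,
`a_l ≡ a_{l,p} (mod p)` for `p ≠ l`, so "l'entier algébrique `A_l - a_l` a une image dans `𝔽̄_p`
qui est égale à `0` pour tout `p ∈ P`, `p ≠ l`. Comme `P` est infini, cela entraîne
(4.6.4) `A_l = a_l` pour tout `l ∤ N`"; the `A_l` are then integers and define a Weil curve `E_F`
(Eichler–Shimura) with `E ~ E_F` (Faltings), and `F` is primitive (Remarque (2), Carayol).

**In-tree form.**  The hypothesis `h` is (3.3.1_?) for the curve `E = W` in the shape delivered by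
the tree's statement of Serre's conjecture (`SerreModularityConjecture` / `khare_wintenberger`,
which already includes the Deligne–Serre lift (3.1.6): a newform in characteristic `0` together
with a reduction map `ι : 𝓞_f → K`): for every prime `p ≥ p₀` and every framed model `ρ̄` of
`E[p]` (`W.IsTorsionGaloisRep p ρ̄`) there are a level `N ≤ M`, a newform `f ∈ S₂(Γ₁(N))`, a field
`K` of characteristic `p` with `j : 𝔽_p → K` and `ι : 𝓞_f → K` such that `ρ̄ ⊗_j K` is attached to
`f` modulo `ker ι` away from `N p` (`IsGaloisRepOfNewform1Int`).  The weight is `2` but the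
nebentypus is not assumed trivial and the level is only bounded (Serre: "ce qui suffirait"): the
proof first shows `ε_{f_p} = 1` for `p > M` (comparing constant terms, `ι(ε(q) q) = q`, and
reducing roots of unity of order `φ(N) < p` injectively modulo `p`,
`nebentypus_apply_eq_one_of_map_coeff_zero_eq`, then Dirichlet's theorem) and descends `f_p` to a
newform `g_p ∈ S₂(Γ₀(N_p))`; the finiteness "il n'y a qu'un nombre fini de `F` possibles" is
`finite_newforms0_holds` (Atkin–Lehner) at the finitely many levels `≤ M`; the congruences
`a_q(g) ≡ a_q(E)` come from the `X`-coefficients of `char(Frob_q)`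
(`charpoly_baseChange_of_isTorsionGaloisRep`), and "`A_l - a_l` … est égale à `0` pour tout
`p ∈ P` … entraîne `A_l = a_l`" is `eq_zero_of_isIntegral_of_forall_exists_map_eq_zero`; the last
paragraph is `isModular_of_isNewform0_of_cuspCoeff_eq_off_of_three_facts` (`hES`, `hF`, `hC`).
The conclusion `IsModular W` is "`E` est une courbe de Weil de niveau `N`" in the tree's sense
(BCDT condition (2): the newform of level `N_E` with `aₙ(f) = aₙ(E)`).
[cite: Serre1987, §4.6, Théorème 4 and its proof (with Lemme 5, (4.6.4), Remarque (2))] -/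
theorem isModular_of_forall_isTorsionGaloisRep_exists_isNewform1_of_three_facts
    (hES : eichlerShimuraConstruction)
    (hF : WeierstrassCurve.isIsogenous_iff_frobeniusTrace_eq)
    (hC : ∀ (N : ℕ) [NeZero N], IsNewformOf.level_eq_conductorNorm (N := N))
    (W : WeierstrassCurve ℚ) [W.IsElliptic] [NeZero (W.conductorNorm ℤ)] (M p₀ : ℕ)
    (h : ∀ (p : ℕ) [Fact p.Prime], p₀ ≤ p →
      ∀ ρ : ModPGaloisRep ℚ (ZMod p) 2, W.IsTorsionGaloisRep p ρ →
        ∃ (N : ℕ) (_ : NeZero N) (_ : N ≤ M) (f : CuspForm (Gamma1 N) 2)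
          (K : Type) (_ : Field K) (_ : CharP K p) (_ : TopologicalSpace K)
          (j : ZMod p →+* K) (ι : coeffCharIntegers f →+* K),
          IsNewform1 f ∧
            IsGaloisRepOfNewform1Int f ι {q | q ∣ N * p}
              (FramedRep.baseChange j continuous_of_discreteTopology ρ)) :
    IsModular W := by
  classical
  /- Step 0. The infinite set `P0` of primes `p ≥ p₀`, `p > M`. -/
  set B : ℕ := max p₀ (M + 1) with hB
  set P0 : Set ℕ := {p | p.Prime ∧ B ≤ p} with hP0
  have hP0inf : P0.Infinite := by
    refine Set.infinite_of_not_bddAbove ?_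
    rintro ⟨b, hb⟩
    obtain ⟨p, hle, hp⟩ := Nat.exists_infinite_primes (max B (b + 1))
    have hpP : p ∈ P0 := ⟨hp, le_of_max_le_left hle⟩
    have := hb hpP
    omega
  haveI hfact : ∀ p : P0, Fact (p : ℕ).Prime := fun p ↦ ⟨p.2.1⟩
  have hBp : ∀ p : P0, B ≤ (p : ℕ) := fun p ↦ p.2.2
  have hMp : ∀ p : P0, M < (p : ℕ) := fun p ↦
    lt_of_lt_of_le (Nat.lt_succ_self M) ((le_max_right _ _).trans (hBp p))
  /- Step 1. For `p ∈ P0`: a framed model `ρ̄_p` of `E[p]` and the newform `f_p` of (3.3.1). -/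
  have hdata : ∀ p : P0, ∃ (N : ℕ) (_ : NeZero N) (_ : N ≤ M) (f : CuspForm (Gamma1 N) 2)
      (K : Type) (_ : Field K) (_ : CharP K p) (_ : TopologicalSpace K)
      (j : ZMod p →+* K) (ι : coeffCharIntegers f →+* K) (ρ : ModPGaloisRep ℚ (ZMod p) 2),
      W.IsTorsionGaloisRep p ρ ∧ IsNewform1 f ∧
        IsGaloisRepOfNewform1Int f ι {q | q ∣ N * p}
          (FramedRep.baseChange j continuous_of_discreteTopology ρ) := by
    intro p
    haveI : NeZero ((p : ℕ) : ℚ) := ⟨by exact_mod_cast p.2.1.ne_zero⟩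
    obtain ⟨ρ, hρ⟩ := W.exists_isTorsionGaloisRep p
    obtain ⟨N, hN, hNM, f, K, hK, hKp, hKt, j, ι, hf, hgal⟩ :=
      h p ((le_max_left _ _).trans (hBp p)) ρ hρ
    exact ⟨N, hN, hNM, f, K, hK, hKp, hKt, j, ι, ρ, hρ, hf, hgal⟩
  choose N_ hN_ hNM_ f_ K_ hK_ hKp_ hKt_ j_ ι_ ρ_ hρ_ hf_ hgal_ using hdata
  /- Step 2. Comparison of Frobenius polynomials at a prime `q ∤ N_p p N_E`: the integral Hecke
  polynomial `P` of `f_p` at `q` satisfies `ι(P₁) = -a_q(E)` and `ι(P₀) = q` in `K_p`. -/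
  have hextract : ∀ (p : P0) (q : ℕ), q.Prime → ¬ q ∣ N_ p → q ≠ (p : ℕ) →
      ¬ q ∣ W.conductorNorm ℤ →
      ∃ P : Polynomial (coeffCharIntegers (f_ p)),
        P.map (algebraMap (coeffCharIntegers (f_ p)) (coeffCharField (f_ p))) =
            heckePolynomial (f_ p) q ∧
          ι_ p (P.coeff 1) = -((W.LFunction q : ℤ) : K_ p) ∧ ι_ p (P.coeff 0) = (q : K_ p) := by
    intro p q hq hqN hqp hqE
    obtain ⟨v, rfl⟩ : ∃ v : HeightOneSpectrum (𝓞 ℚ), (primesEquiv v : ℕ) = q :=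
      ⟨primesEquiv.symm ⟨q, hq⟩, by rw [Equiv.apply_symm_apply]⟩
    have hvS : ((primesEquiv v : Nat.Primes) : ℕ) ∉ {q | q ∣ N_ p * p} := by
      intro h'
      rcases (Nat.Prime.dvd_mul hq).mp h' with h1 | h1
      · exact hqN h1
      · exact hqp ((Nat.prime_dvd_prime_iff_eq hq p.2.1).mp h1)
    obtain ⟨-, P, hP, hch⟩ := hgal_ p v hvS
    obtain ⟨𝔓, h𝔓⟩ := primesAbove_nonempty v
    obtain ⟨σ, hσ⟩ := exists_isArithFrobAt_of_mem_primesAbove_holds (v := v) h𝔓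
    have hgood : W.HasGoodReductionAt v := by
      by_contra h'
      exact hqE ((W.dvd_conductorNorm_iff v).mpr h')
    have h1 := hch 𝔓 h𝔓 σ hσ
    rw [charpoly_baseChange_of_isTorsionGaloisRep W (hρ_ p) (j_ p) _ hqp hgood h𝔓 hσ] at h1
    refine ⟨P, hP, ?_, ?_⟩
    · have h2 := congrArg (fun Q : Polynomial (K_ p) ↦ Q.coeff 1) h1
      simp only [Polynomial.coeff_map, coeff_add, coeff_sub, coeff_X_pow, coeff_C_mul,
        coeff_X_one, coeff_C_succ] at h2
      rw [← h2]
      simp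
    · have h2 := congrArg (fun Q : Polynomial (K_ p) ↦ Q.coeff 0) h1
      simp only [Polynomial.coeff_map, coeff_add, coeff_sub, coeff_X_pow, coeff_C_mul,
        coeff_X_zero, coeff_C_zero] at h2
      rw [← h2]
      simp
  /- Step 3. For `p ∈ P0` (`p > M ≥ N_p`): `ε_{f_p} = 1`, and `f_p` descends to a newform
  `g_p ∈ S₂(Γ₀(N_p))` with the same `q`-expansion. -/
  have hε : ∀ p : P0, nebentypus (f_ p) = 1 := by
    intro p
    refine nebentypus_eq_one_of_forall_prime (max (p : ℕ) (W.conductorNorm ℤ)) ?_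
    intro q hq hqB hqN
    have hqp : q ≠ (p : ℕ) := fun h' ↦ (lt_of_le_of_lt (le_max_left _ _) hqB).ne' h'
    have hqE : ¬ q ∣ W.conductorNorm ℤ := fun h' ↦
      (Nat.le_of_dvd (conductorNorm_pos_holds W) h').not_gt (lt_of_le_of_lt (le_max_right _ _) hqB)
    obtain ⟨P, hP, -, h0⟩ := hextract p q hq hqN hqp hqE
    exact nebentypus_apply_eq_one_of_map_coeff_zero_eq hq hqN hP (ι_ p) hqp
      ((hNM_ p).trans_lt (hMp p)) h0
  have hg : ∀ p : P0, ∃ g : CuspForm (Gamma0 (N_ p)) 2,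
      IsNewform0 g ∧ (⇑g : UpperHalfPlane → ℂ) = ⇑(f_ p) := fun p ↦
    exists_isNewform0_coe_eq_of_nebentypus_eq_one (hf_ p) (hε p)
  choose g_ hg_ hgf_ using hg
  /- Step 4. "Il n'y a qu'un nombre fini de `F` possibles": pigeonhole over the finitely many
  pairs (level `≤ M`, newform on `Γ₀` of that level). -/
  set T : Set (ℕ × (UpperHalfPlane → ℂ)) :=
    ⋃ x : {n : ℕ // 0 < n ∧ n ≤ M},
      (haveI : NeZero x.1 := ⟨x.2.1.ne'⟩;
        (fun g : CuspForm (Gamma0 x.1) 2 ↦ ((x.1 : ℕ), (⇑g : UpperHalfPlane → ℂ))) ''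
          newforms0 x.1 2) with hT
  have hTfin : T.Finite := by
    haveI : Finite {n : ℕ // 0 < n ∧ n ≤ M} :=
      Set.Finite.to_subtype ((Set.finite_Iic M).subset fun n hn ↦ hn.2)
    refine Set.finite_iUnion fun x ↦ ?_
    haveI : NeZero x.1 := ⟨x.2.1.ne'⟩
    exact (finite_newforms0_holds x.1 2).image _
  have hΦ : ∀ p : P0, ((N_ p, (⇑(g_ p) : UpperHalfPlane → ℂ)) : ℕ × (UpperHalfPlane → ℂ)) ∈ T := by
    intro p
    refine Set.mem_iUnion.mpr ⟨⟨N_ p, Nat.pos_of_ne_zero (NeZero.ne _), hNM_ p⟩, ?_⟩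
    exact ⟨g_ p, hg_ p, rfl⟩
  haveI : Infinite P0 := hP0inf.to_subtype
  haveI : Finite T := hTfin.to_subtype
  obtain ⟨y, hy⟩ := Finite.exists_infinite_fiber
    (fun p : P0 ↦ (⟨(N_ p, (⇑(g_ p) : UpperHalfPlane → ℂ)), hΦ p⟩ : T))
  set P1 : Set P0 :=
    (fun p : P0 ↦ (⟨(N_ p, (⇑(g_ p) : UpperHalfPlane → ℂ)), hΦ p⟩ : T)) ⁻¹' {y} with hP1
  have hP1inf : P1.Infinite := Set.infinite_coe_iff.mp hy
  obtain ⟨⟨n₀, hn₀pos, hn₀M⟩, hy'⟩ := Set.mem_iUnion.mp y.2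
  haveI hn₀ : NeZero n₀ := ⟨hn₀pos.ne'⟩
  obtain ⟨g₀, hg₀, hy₀⟩ := hy'
  -- on the fibre: `N_p = n₀` and `g_p`, `f_p` have the `q`-expansion of `g₀`
  have hfib : ∀ p : P0, p ∈ P1 → N_ p = n₀ ∧ (⇑(f_ p) : UpperHalfPlane → ℂ) = ⇑g₀ := by
    intro p hp
    have h' : ((N_ p, (⇑(g_ p) : UpperHalfPlane → ℂ)) : ℕ × (UpperHalfPlane → ℂ)) = (n₀, ⇑g₀) := by
      have := congrArg Subtype.val (show _ = y from hp)
      exact this.trans hy₀.symm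
    obtain ⟨h1, h2⟩ := Prod.ext_iff.mp h'
    exact ⟨h1, (hgf_ p).symm.trans h2⟩
  /- Step 5. `a_q(g₀) = a_q(E)` for every prime `q ∤ n₀ N_E`: the algebraic integer
  `a_q(E) - a_q(g₀)` vanishes modulo `p` for the infinitely many `p ∈ P1`, `p ≠ q`. -/
  have hcoeff : ∀ q : ℕ, q.Prime → ¬ q ∣ n₀ * W.conductorNorm ℤ →
      cuspCoeff g₀ q = (W.LFunction q : ℂ) := by
    intro q hq hqM
    have hqn : ¬ q ∣ n₀ := fun h' ↦ hqM (dvd_mul_of_dvd_left h' _)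
    have hqE : ¬ q ∣ W.conductorNorm ℤ := fun h' ↦ hqM (dvd_mul_of_dvd_right h' _)
    -- the index set: `p ∈ P1`, `p ≠ q`
    set I : Set P0 := {p | p ∈ P1 ∧ (p : ℕ) ≠ q} with hI
    have hIlarge : ∀ n : ℕ, ∃ p : P0, p ∈ I ∧ n < (p : ℕ) := by
      intro n
      have hfin : {p : P0 | (p : ℕ) ≤ max n q}.Finite :=
        (Set.finite_Iic (max n q)).preimage Subtype.val_injective.injOn
      obtain ⟨p, hp1, hp2⟩ := (hP1inf.sdiff hfin).nonempty
      simp only [Set.mem_setOf_eq, not_le] at hp2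
      exact ⟨p, ⟨hp1, fun h' ↦ (lt_of_le_of_lt (le_max_right _ _) hp2).ne' h'⟩,
        lt_of_le_of_lt (le_max_left _ _) hp2⟩
    -- for `p ∈ I`: the integral element `x_p = P₁ + a_q(E) ∈ 𝓞_{f_p}` with `x_p ↦ ξ` in `ℂ` and
    -- `ι_p(x_p) = 0`
    set ξ : ℂ := -cuspCoeff g₀ q + (W.LFunction q : ℂ) with hξ
    have hx : ∀ i : I, ∃ x : coeffCharIntegers (f_ i.1),
        (algebraMap (coeffCharField (f_ i.1)) ℂ)
            ((algebraMap (coeffCharIntegers (f_ i.1)) (coeffCharField (f_ i.1))) x) = ξ ∧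
          ι_ i.1 x = 0 := by
      rintro ⟨p, hpP1, hpq⟩
      obtain ⟨hNp, hfp⟩ := hfib p hpP1
      obtain ⟨P, hP, h1, -⟩ := hextract p q hq (hNp ▸ hqn) hpq.symm hqE
      refine ⟨P.coeff 1 + ((W.LFunction q : ℤ) : coeffCharIntegers (f_ p)), ?_, ?_⟩
      · rw [map_add, map_add, (coeff_of_map_eq_heckePolynomial hP).1, map_intCast, map_intCast, hξ,
          cuspCoeff, hfp]
      · rw [map_add, h1, map_intCast, neg_add_cancel]
    choose x_ hxξ_ hxι_ using hx
    have hξ0 : ξ = 0 := by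
      obtain ⟨p1, hp1, -⟩ := hIlarge 0
      have hint : IsIntegral ℤ ξ := by
        rw [← hxξ_ ⟨p1, hp1⟩]
        exact (isIntegral_coeffCharField_iff _).mp (x_ ⟨p1, hp1⟩).2
      refine eq_zero_of_isIntegral_of_forall_exists_map_eq_zero hint (fun i : I ↦ ((i : P0) : ℕ))
        (fun i ↦ coeffCharIntegers (f_ i.1))
        (fun i ↦ (algebraMap (coeffCharField (f_ i.1)) ℂ).comp
          (algebraMap (coeffCharIntegers (f_ i.1)) (coeffCharField (f_ i.1))))
        (fun i ↦ algebraMap_coeffCharIntegers_complex_injective (f_ i.1)) x_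
        (fun i ↦ hxξ_ i) (fun i ↦ K_ i.1) (fun i ↦ ι_ i.1) hxι_ fun n ↦ ?_
      obtain ⟨p, hp, hnp⟩ := hIlarge n
      exact ⟨⟨p, hp⟩, hnp⟩
    have := hξ0
    rw [hξ, neg_add_eq_zero] at this
    exact this
  /- Step 6. Eichler–Shimura, Faltings, Carayol. -/
  haveI : NeZero (W.conductorNorm ℤ) := inferInstance
  exact isModular_of_isNewform0_of_cuspCoeff_eq_off_of_three_facts hES hF hC W hg₀
    (R := W.conductorNorm ℤ) hcoeff

/-! ## Part F. The hypothesis of Part E from the Khare–Wintenberger theorem (Serre (3.2.4)),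
the weight (`k = 2`, Serre §2.8 Prop. 4) and the level (`N_p ∣ N`, Serre (4.6.3)) of `ρ̄_{E,p}` -/

section KhareWintenberger

open ValuativeRel GaloisRepresentations.ModPGaloisRep GaloisRepresentations.IsNonarchimedeanLocalField

/-- **`E[p]` irreducible ⇒ every framed model of `E[p]` is irreducible.**  If the only
`Γ_ℚ`-stable subgroups of `E[p]` are `0` and `E[p]` (`W.HasIrreducibleModPGaloisRep p`,
`GaloisAction`), then any framed `ρ̄ : Γ_ℚ →ₜ* GL₂(𝔽_p)` with `W.IsTorsionGaloisRep p ρ̄` is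
irreducible (`FramedRep.IsIrreducible`, Mathlib `Representation.IsIrreducible`): a
subrepresentation of `𝔽_p²` pulls back along the frame `e : E[p] ≃ 𝔽_p²` to a `Γ_ℚ`-stable subgroup
of `E[p]`.  (Serre 1972, §4; Silverman *AEC* III.§7: "the representation of `G` on `E[ℓ]` is
irreducible".) [folklore] -/
theorem isIrreducible_of_hasIrreducibleModPGaloisRep {W : WeierstrassCurve ℚ} {p : ℕ}
    [Fact p.Prime] (hirr : W.HasIrreducibleModPGaloisRep p) {ρ : ModPGaloisRep ℚ (ZMod p) 2}
    (hρ : W.IsTorsionGaloisRep p ρ) : FramedRep.IsIrreducible ρ := by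
  obtain ⟨e, he⟩ := hρ
  have hbt : (⊥ : Subrepresentation (FramedRep.toRepresentation ρ)) ≠ ⊤ := by
    intro h
    have h' : (⊥ : Submodule (ZMod p) (Fin 2 → ZMod p)) = ⊤ :=
      congrArg Subrepresentation.toSubmodule h
    exact bot_ne_top h'
  refine { toNontrivial := ⟨⟨⊥, ⊤, hbt⟩⟩, eq_bot_or_eq_top := fun V ↦ ?_ }
  -- pull `V` back to a `Γ_ℚ`-stable subgroup `H` of `E[p]`
  let H : AddSubgroup (geomTorsion W p) := V.toSubmodule.toAddSubgroup.comap e.toAddMonoidHom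
  have hHmem : ∀ Q : geomTorsion W p, Q ∈ H ↔ e Q ∈ V.toSubmodule := fun Q ↦ Iff.rfl
  have hH : ∀ σ : Field.absoluteGaloisGroup ℚ, ∀ Q ∈ H, σ • Q ∈ H := by
    intro σ Q hQ
    rw [hHmem] at hQ ⊢
    rw [he σ Q]
    exact V.apply_mem_toSubmodule σ hQ
  rcases hirr H hH with hH0 | hH1
  · left
    apply Subrepresentation.toSubmodule_injective
    change V.toSubmodule = ⊥
    refine (Submodule.eq_bot_iff _).mpr fun x hx ↦ ?_
    have hx' : e.symm x ∈ H := by rw [hHmem, e.apply_symm_apply]; exact hx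
    rw [hH0, AddSubgroup.mem_bot] at hx'
    rw [← e.apply_symm_apply x, hx', map_zero]
  · right
    apply Subrepresentation.toSubmodule_injective
    change V.toSubmodule = ⊤
    refine Submodule.eq_top_iff'.mpr fun x ↦ ?_
    have hx' : e.symm x ∈ H := by rw [hH1]; exact AddSubgroup.mem_top _
    rw [hHmem, e.apply_symm_apply] at hx'
    exact hx'

/-- **`E[p]` irreducible ⇒ `ρ̄_{E,p}` absolutely irreducible, for `p ≠ 2`**: `ρ̄_{E,p}` is odd
(`det ρ̄_{E,p} = χ̄_p`, the Weil pairing, `det_eq_modPCyclotomicCharacter_of_isTorsionGaloisRep_holds`;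
`χ̄_p(c) = -1`), and an odd irreducible plane representation in characteristic `≠ 2` is absolutely
irreducible (`FramedRep.isAbsolutelyIrreducible_of_isIrreducible_of_det_eq_neg_one`).  This is
Serre's remark (b′) ⇒ (b) of n° 3.3 (Duke Math. J. 54 (1987)): "(a) entraîne que `det ρ` est
impair, donc que les valeurs propres de `ρ(c)` sont `+1` et `-1`; du fait que `p ≠ 2`, ces valeurs
propres sont distinctes …". [cite: Serre1987, §3.3, (b′) ⇒ (b)] -/
theorem isAbsolutelyIrreducible_of_hasIrreducibleModPGaloisRep (W : WeierstrassCurve ℚ)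
    [W.IsElliptic] {p : ℕ} [Fact p.Prime] (hp2 : p ≠ 2) (hirr : W.HasIrreducibleModPGaloisRep p)
    {ρ : ModPGaloisRep ℚ (ZMod p) 2} (hρ : W.IsTorsionGaloisRep p ρ) :
    FramedRep.IsAbsolutelyIrreducible ρ := by
  have hp : p.Prime := Fact.out
  haveI : NeZero ((p : ℕ) : ℚ) := ⟨by exact_mod_cast hp.ne_zero⟩
  obtain ⟨c, hc⟩ := GaloisRepresentations.exists_isComplexConjugation (Rat.castHom ℝ)
  have hcc : c * c = 1 := by rw [← pow_two]; exact hc.sq_eq_one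
  have h2 : (2 : ZMod p) ≠ 0 := by
    change ((2 : ℕ) : ZMod p) ≠ 0
    rw [Ne, ZMod.natCast_eq_zero_iff]
    intro h
    exact hp2 ((Nat.prime_dvd_prime_iff_eq hp Nat.prime_two).mp h)
  refine FramedRep.isAbsolutelyIrreducible_of_isIrreducible_of_det_eq_neg_one ρ
    (isIrreducible_of_hasIrreducibleModPGaloisRep hirr hρ) h2 hcc ?_
  rw [W.det_eq_modPCyclotomicCharacter_of_isTorsionGaloisRep_holds p ρ hρ c,
    GaloisRepresentations.modPCyclotomicCharacterZMod_eq_modNCyclotomicCharacter]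
  ext
  simpa using GaloisRepresentations.modNCyclotomicCharacter_of_isComplexConjugation (N := p) hc

/-- **Serre's (3.3.1) for `ρ̄_{E,p}`, `p` large, from Khare–Wintenberger, the weight and the
level.**  Let `E = W` be an elliptic curve over `ℚ` and suppose, for all primes `p ≥ p₀`:

* `hKW` — Serre's conjecture in its strong form (3.2.4) at `p` (the tree's named fact
  `khare_wintenberger p k`, Khare–Wintenberger, Invent. Math. 178 (2009), Thm. 1.2 and 9.1, for
  every discrete algebraically closed field `k` of characteristic `p`);
* `hwt` — **the weight of `ρ̄_{E,p}` is `2`**: `k(ρ̄_{E,p} ⊗ k) = 2` for every local restriction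
  datum and residue embedding (Serre, Duke Math. J. 54 (1987), §2.8, Prop. 4 with (4.6.1)
  `det ρ_p^E = χ` and n° 4.6: "Lorsque `E` a bonne réduction, `ρ_p` est évidemment finie en `p`",
  i.e. `k = 2` for `p ∤ N_E`; Raynaud's theory of finite flat group schemes of type `(p, …, p)`);
* `hlev` — **the level of `ρ̄_{E,p}` divides `N_E`**: `N(ρ̄_{E,p} ⊗ k) ∣ N_E` (Serre, loc. cit.,
  Lemme 5, (4.6.3): "le conducteur `N_p` de `ρ_p^E` divise `N` (ce qui d'ailleurs suffirait pour
  la suite)"; Carayol, and the definition of `N_E` by `ℓ`-adic representations).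

Then for all large `p` and every framed model `ρ̄` of `E[p]`, `ρ̄ ⊗ 𝔽̄_p` is attached, modulo a
prime above `p`, to a newform `f ∈ S₂(Γ₁(N))` of some level `N ≤ N_E` — the hypothesis of
`isModular_of_forall_isTorsionGaloisRep_exists_isNewform1_of_three_facts`.  Proof: for `p > 2`
beyond the finitely many primes at which `E[p]` is reducible (Serre 1968 / Silverman IX.6.3, the
tree's theorem `WeierstrassCurve.exists_forall_hasIrreducibleModPGaloisRep_of_lt`; Serre uses
Mazur's theorem, (4.6.2)), `ρ̄ = ρ̄_{E,p}` is absolutely irreducible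
(`isAbsolutelyIrreducible_of_hasIrreducibleModPGaloisRep`) and odd, so `ρ̄ ⊗ 𝔽̄_p` (discrete
topology on `𝔽̄_p = AlgebraicClosure (ZMod p)`) is irreducible and odd; Serre (3.2.4) at a local
restriction datum and a residue embedding (`nonempty_localRestrictionAt`,
`nonempty_ringHom_residue`) yields a newform of weight `k(ρ̄) = 2` (`hwt`) and level
`N(ρ̄) ∣ N_E` (`hlev`). [cite: Serre1987, §4.6, proof of Théorème 4 (Lemme 5, application of (3.3.1))] -/
theorem forall_isTorsionGaloisRep_exists_isNewform1_of_khare_wintenberger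
    (W : WeierstrassCurve ℚ) [W.IsElliptic] (p₀ : ℕ)
    (hKW : ∀ (p : ℕ) [Fact p.Prime], p₀ ≤ p →
      ∀ (k : Type) [Field k] [TopologicalSpace k] [DiscreteTopology k], khare_wintenberger p k)
    (hwt : ∀ (p : ℕ) [Fact p.Prime], p₀ ≤ p →
      ∀ ρ : ModPGaloisRep ℚ (ZMod p) 2, W.IsTorsionGaloisRep p ρ →
        ∀ (k : Type) [Field k] [TopologicalSpace k] [DiscreteTopology k] [CharP k p]
          [IsAlgClosed k] (j : ZMod p →+* k)
          (loc : LocalRestrictionAt p (FramedRep.baseChange j continuous_of_discreteTopology ρ))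
          (ι : absIntegers 𝒪[loc.F] loc.F ⧸ absMaximalIdeal loc.F →+* k),
          serreWeight p (FramedRep.baseChange j continuous_of_discreteTopology ρ) loc ι = 2)
    (hlev : ∀ (p : ℕ) [Fact p.Prime], p₀ ≤ p →
      ∀ ρ : ModPGaloisRep ℚ (ZMod p) 2, W.IsTorsionGaloisRep p ρ →
        ∀ (k : Type) [Field k] [TopologicalSpace k] [DiscreteTopology k] [CharP k p]
          [IsAlgClosed k] (j : ZMod p →+* k),
          serreLevel p (FramedRep.baseChange j continuous_of_discreteTopology ρ) ∣
            W.conductorNorm ℤ) :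
    ∃ p₁ : ℕ, ∀ (p : ℕ) [Fact p.Prime], p₁ ≤ p →
      ∀ ρ : ModPGaloisRep ℚ (ZMod p) 2, W.IsTorsionGaloisRep p ρ →
        ∃ (N : ℕ) (_ : NeZero N) (_ : N ≤ W.conductorNorm ℤ) (f : CuspForm (Gamma1 N) 2)
          (K : Type) (_ : Field K) (_ : CharP K p) (_ : TopologicalSpace K)
          (j : ZMod p →+* K) (ι : coeffCharIntegers f →+* K),
          IsNewform1 f ∧
            IsGaloisRepOfNewform1Int f ι {q | q ∣ N * p}
              (FramedRep.baseChange j continuous_of_discreteTopology ρ) := by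
  obtain ⟨n₁, hn₁⟩ := W.exists_forall_hasIrreducibleModPGaloisRep_of_lt
  refine ⟨max (max p₀ 3) (n₁ + 1), fun p _ hp ρ hρ ↦ ?_⟩
  have hpp : p.Prime := Fact.out
  have hp₀ : p₀ ≤ p := (le_max_left _ _).trans ((le_max_left _ _).trans hp)
  have hp2 : p ≠ 2 := by
    have : 3 ≤ p := (le_max_right _ _).trans ((le_max_left _ _).trans hp)
    omega
  have hpn : n₁ < p := Nat.lt_of_succ_le ((le_max_right _ _).trans hp)
  haveI : NeZero ((p : ℕ) : ℚ) := ⟨by exact_mod_cast hpp.ne_zero⟩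
  -- coefficients `𝔽̄_p` with the discrete topology
  letI : TopologicalSpace (AlgebraicClosure (ZMod p)) := ⊥
  haveI : DiscreteTopology (AlgebraicClosure (ZMod p)) := ⟨rfl⟩
  set j : ZMod p →+* AlgebraicClosure (ZMod p) := algebraMap (ZMod p) (AlgebraicClosure (ZMod p))
    with hj
  set ρ' : ModPGaloisRep ℚ (AlgebraicClosure (ZMod p)) 2 :=
    FramedRep.baseChange j continuous_of_discreteTopology ρ with hρ'
  -- `ρ̄ ⊗ 𝔽̄_p` is irreducible and odd
  have habs := isAbsolutelyIrreducible_of_hasIrreducibleModPGaloisRep W hp2 (hn₁ p hpn hpp) hρ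
  have hirr : ρ'.toGaloisRep.IsIrreducible := by
    rw [← ModPGaloisRep.isIrreducible_iff_toGaloisRep]
    exact habs.isIrreducible_baseChange (AlgebraicClosure (ZMod p)) j _
  have hodd : FramedGaloisRep.IsOdd ρ' :=
    (ModPGaloisRep.isOdd_of_det_eq_modPCyclotomicCharacterZMod ρ
      (W.det_eq_modPCyclotomicCharacter_of_isTorsionGaloisRep_holds p ρ hρ)).baseChange j _
  -- Serre (3.2.4) at a local restriction datum and a residue embedding
  obtain ⟨loc⟩ := nonempty_localRestrictionAt p ρ'
  obtain ⟨ι⟩ := nonempty_ringHom_residue (k := AlgebraicClosure (ZMod p)) p loc.F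
    loc.residueFieldCard_eq
  obtain ⟨f, ιf, hf, hgal⟩ := hKW p hp₀ (AlgebraicClosure (ZMod p)) ρ' hirr hodd loc ι
  have hw : (serreWeight p ρ' loc ι : ℤ) = 2 := by
    have h2 : serreWeight p ρ' loc ι = 2 := hwt p hp₀ ρ hρ (AlgebraicClosure (ZMod p)) j loc ι
    rw [h2]; rfl
  have hl : serreLevel p ρ' ∣ W.conductorNorm ℤ := hlev p hp₀ ρ hρ (AlgebraicClosure (ZMod p)) j
  haveI hNz : NeZero (serreLevel p ρ') := ⟨fun h0 ↦ not_dvd_serreLevel p ρ' (h0 ▸ dvd_zero p)⟩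
  -- transport along `k(ρ̄) = 2`
  revert hgal hf ιf f
  rw [hw]
  intro f ιf hf hgal
  exact ⟨serreLevel p ρ', hNz, Nat.le_of_dvd (conductorNorm_pos_holds W) hl, f,
    AlgebraicClosure (ZMod p), inferInstance, inferInstance, ⊥, j, ιf, hf, hgal⟩

end KhareWintenberger

/-! ## Part G. Corollaries: `E` modular, Theorem A and CDT Theorem 7.2.2 along Serre's road -/

section Corollaries

open ValuativeRel GaloisRepresentations.ModPGaloisRep GaloisRepresentations.IsNonarchimedeanLocalField

/-- **`E` is modular — Serre's Théorème 4 with (3.3.1) supplied by Khare–Wintenberger, the weight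
and the level of `ρ̄_{E,p}`, and Eichler–Shimura, Faltings, Carayol.**  For an elliptic `W / ℚ`:
if for all primes `p ≥ p₀` Serre's conjecture (3.2.4) holds at `p` (`khare_wintenberger p k`),
`k(ρ̄_{E,p} ⊗ k) = 2` (`hwt`, Serre 1987 §2.8 Prop. 4) and `N(ρ̄_{E,p} ⊗ k) ∣ N_E` (`hlev`, Serre
1987 (4.6.3)), then, granted `hES`, `hF`, `hC`, `E` is modular
(`forall_isTorsionGaloisRep_exists_isNewform1_of_khare_wintenberger` and
`isModular_of_forall_isTorsionGaloisRep_exists_isNewform1_of_three_facts` with `M = N_E`).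
[cite: Serre1987, §4.6, Théorème 4] -/
theorem isModular_of_khare_wintenberger_of_serreWeight_of_serreLevel_of_three_facts
    (hES : eichlerShimuraConstruction)
    (hF : WeierstrassCurve.isIsogenous_iff_frobeniusTrace_eq)
    (hC : ∀ (N : ℕ) [NeZero N], IsNewformOf.level_eq_conductorNorm (N := N))
    (W : WeierstrassCurve ℚ) [W.IsElliptic] [NeZero (W.conductorNorm ℤ)] (p₀ : ℕ)
    (hKW : ∀ (p : ℕ) [Fact p.Prime], p₀ ≤ p →
      ∀ (k : Type) [Field k] [TopologicalSpace k] [DiscreteTopology k], khare_wintenberger p k)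
    (hwt : ∀ (p : ℕ) [Fact p.Prime], p₀ ≤ p →
      ∀ ρ : ModPGaloisRep ℚ (ZMod p) 2, W.IsTorsionGaloisRep p ρ →
        ∀ (k : Type) [Field k] [TopologicalSpace k] [DiscreteTopology k] [CharP k p]
          [IsAlgClosed k] (j : ZMod p →+* k)
          (loc : LocalRestrictionAt p (FramedRep.baseChange j continuous_of_discreteTopology ρ))
          (ι : absIntegers 𝒪[loc.F] loc.F ⧸ absMaximalIdeal loc.F →+* k),
          serreWeight p (FramedRep.baseChange j continuous_of_discreteTopology ρ) loc ι = 2)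
    (hlev : ∀ (p : ℕ) [Fact p.Prime], p₀ ≤ p →
      ∀ ρ : ModPGaloisRep ℚ (ZMod p) 2, W.IsTorsionGaloisRep p ρ →
        ∀ (k : Type) [Field k] [TopologicalSpace k] [DiscreteTopology k] [CharP k p]
          [IsAlgClosed k] (j : ZMod p →+* k),
          serreLevel p (FramedRep.baseChange j continuous_of_discreteTopology ρ) ∣
            W.conductorNorm ℤ) :
    IsModular W := by
  obtain ⟨p₁, h⟩ :=
    forall_isTorsionGaloisRep_exists_isNewform1_of_khare_wintenberger W p₀ hKW hwt hlev
  exact isModular_of_forall_isTorsionGaloisRep_exists_isNewform1_of_three_facts hES hF hC W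
    (W.conductorNorm ℤ) p₁ fun p _ hp ρ hρ ↦ h p hp ρ hρ

/-- **BCDT Theorem A (the Modularity Theorem, `exists_isNewformOf`) along Serre's road**:
trust base {`khare_wintenberger p k` (all primes `p`, all discrete `k`; Khare–Wintenberger 2009),
the weight of `ρ̄_{E,p}` (`hwt`: for every `E` and all large `p`, `k(ρ̄_{E,p} ⊗ k) = 2`; Serre 1987
§2.8 Prop. 4), the level of `ρ̄_{E,p}` (`hlev`: `N(ρ̄_{E,p} ⊗ k) ∣ N_E` for large `p`; Serre 1987
(4.6.3)), `eichlerShimuraConstruction`, `WeierstrassCurve.isIsogenous_iff_frobeniusTrace_eq`,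
`IsNewformOf.level_eq_conductorNorm`} — no modularity lifting theorem of Wiles / Taylor–Wiles /
Conrad–Diamond–Taylor / BCDT enters (Serre, Duke Math. J. 54 (1987), §4.6, Thm. 4: "(3.3.1_?) ⇒
Taniyama–Weil"; Khare–Wintenberger (I), §10). [cite: Serre1987, §4.6, Théorème 4] -/
theorem exists_isNewformOf_of_khare_wintenberger_of_serreWeight_of_serreLevel_of_three_facts
    (hKW : ∀ (p : ℕ) [Fact p.Prime] (k : Type) [Field k] [TopologicalSpace k] [DiscreteTopology k],
      khare_wintenberger p k)
    (hwt : ∀ (W : WeierstrassCurve ℚ) [W.IsElliptic], ∃ p₀ : ℕ, ∀ (p : ℕ) [Fact p.Prime], p₀ ≤ p →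
      ∀ ρ : ModPGaloisRep ℚ (ZMod p) 2, W.IsTorsionGaloisRep p ρ →
        ∀ (k : Type) [Field k] [TopologicalSpace k] [DiscreteTopology k] [CharP k p]
          [IsAlgClosed k] (j : ZMod p →+* k)
          (loc : LocalRestrictionAt p (FramedRep.baseChange j continuous_of_discreteTopology ρ))
          (ι : absIntegers 𝒪[loc.F] loc.F ⧸ absMaximalIdeal loc.F →+* k),
          serreWeight p (FramedRep.baseChange j continuous_of_discreteTopology ρ) loc ι = 2)
    (hlev : ∀ (W : WeierstrassCurve ℚ) [W.IsElliptic], ∃ p₀ : ℕ, ∀ (p : ℕ) [Fact p.Prime],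
      p₀ ≤ p → ∀ ρ : ModPGaloisRep ℚ (ZMod p) 2, W.IsTorsionGaloisRep p ρ →
        ∀ (k : Type) [Field k] [TopologicalSpace k] [DiscreteTopology k] [CharP k p]
          [IsAlgClosed k] (j : ZMod p →+* k),
          serreLevel p (FramedRep.baseChange j continuous_of_discreteTopology ρ) ∣
            W.conductorNorm ℤ)
    (hES : eichlerShimuraConstruction)
    (hF : WeierstrassCurve.isIsogenous_iff_frobeniusTrace_eq)
    (hC : ∀ (N : ℕ) [NeZero N], IsNewformOf.level_eq_conductorNorm (N := N)) :
    EllipticCurves.ModularForms.exists_isNewformOf := by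
  intro W _ _
  obtain ⟨a, ha⟩ := hwt W
  obtain ⟨b, hb⟩ := hlev W
  exact isModular_of_khare_wintenberger_of_serreWeight_of_serreLevel_of_three_facts hES hF hC W
    (max a b) (fun p _ _ k _ _ _ ↦ hKW p k)
    (fun p _ hp ρ hρ k _ _ _ _ _ j loc ι ↦ ha p ((le_max_left a b).trans hp) ρ hρ k j loc ι)
    (fun p _ hp ρ hρ k _ _ _ _ _ j ↦ hb p ((le_max_right a b).trans hp) ρ hρ k j)

/-- **Conrad–Diamond–Taylor 1999, Theorem 7.2.2, along Serre's road.**  The named fact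
`CDT_theorem_7_2_2` ("`ρ̄_{E,5}|ℚ(√5)` absolutely irreducible and `ρ̄_{E,5}` modular ⇒ `E`
modular") follows — its hypotheses at `5` being unnecessary on this road — from
{`khare_wintenberger` (all `p`), the weight and the level of `ρ̄_{E,p}` for large `p` (Serre 1987,
§2.8 Prop. 4 and (4.6.3)), Eichler–Shimura, Faltings, Carayol}, by
`exists_isNewformOf_of_khare_wintenberger_of_serreWeight_of_serreLevel_of_three_facts`.  (The
printed proof of Thm. 7.2.2 is instead the `5`-adic modularity lifting theorem CDT Thm. 7.1.1 with
Diamond 1996 Thm. 5.3, cf. `CDT_theorem_7_2_2_iff_lift_of_three_facts`; Serre's road trades the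
lifting theorems for Khare–Wintenberger.)
[cite: ConradDiamondTaylor1999, Thm. 7.2.2] [cite: Serre1987, §4.6, Théorème 4] -/
theorem CDT_theorem_7_2_2_of_khare_wintenberger_of_serreWeight_of_serreLevel_of_three_facts
    (hKW : ∀ (p : ℕ) [Fact p.Prime] (k : Type) [Field k] [TopologicalSpace k] [DiscreteTopology k],
      khare_wintenberger p k)
    (hwt : ∀ (W : WeierstrassCurve ℚ) [W.IsElliptic], ∃ p₀ : ℕ, ∀ (p : ℕ) [Fact p.Prime], p₀ ≤ p →
      ∀ ρ : ModPGaloisRep ℚ (ZMod p) 2, W.IsTorsionGaloisRep p ρ →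
        ∀ (k : Type) [Field k] [TopologicalSpace k] [DiscreteTopology k] [CharP k p]
          [IsAlgClosed k] (j : ZMod p →+* k)
          (loc : LocalRestrictionAt p (FramedRep.baseChange j continuous_of_discreteTopology ρ))
          (ι : absIntegers 𝒪[loc.F] loc.F ⧸ absMaximalIdeal loc.F →+* k),
          serreWeight p (FramedRep.baseChange j continuous_of_discreteTopology ρ) loc ι = 2)
    (hlev : ∀ (W : WeierstrassCurve ℚ) [W.IsElliptic], ∃ p₀ : ℕ, ∀ (p : ℕ) [Fact p.Prime],
      p₀ ≤ p → ∀ ρ : ModPGaloisRep ℚ (ZMod p) 2, W.IsTorsionGaloisRep p ρ →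
        ∀ (k : Type) [Field k] [TopologicalSpace k] [DiscreteTopology k] [CharP k p]
          [IsAlgClosed k] (j : ZMod p →+* k),
          serreLevel p (FramedRep.baseChange j continuous_of_discreteTopology ρ) ∣
            W.conductorNorm ℤ)
    (hES : eichlerShimuraConstruction)
    (hF : WeierstrassCurve.isIsogenous_iff_frobeniusTrace_eq)
    (hC : ∀ (N : ℕ) [NeZero N], IsNewformOf.level_eq_conductorNorm (N := N)) :
    CDT_theorem_7_2_2 :=
  fun W _ _ _ _ _ _ ↦
    exists_isNewformOf_of_khare_wintenberger_of_serreWeight_of_serreLevel_of_three_facts hKW hwt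
      hlev hES hF hC W

end Corollaries

end Literature.NumberTheory.Automorphic.BCDT

end
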